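import Summits.ResolutionOfSingularities.ResolutionOfSingularities.Theorems.ThreadCutLaw2
import HarnessLib

/-!
# ThreadCutPinf — decomp-res node «ThreadCut» (lens-5 g31, critic row 198 CLEARED +1), tree file 3/4 of the node

Content VERBATIM from the decomp-res lens-5 g31 node `HOME/decomp-res-lens-5/g31/ThreadCut.lean` (pin 856c26bf; no
carry, imports the landed tree only); HOME = run/shared/lean/pub/decomp-res; critic row 198 CLEARED +1; landing plan
NODE-g31.md 442a09ac §7 + rider INBOX :1203 — provenance, critic text and the lens header in full in the first file
of the node, `ThreadCutLaw`.  Namespace `…Theorems.ThreadCut`; `--supports stmt-ResolutionOfSingularities-31770`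
unless said otherwise.

## This file

§5–§6 (node l. 552–845): `section Existence` (§5 EXACTNESS: `cornerStates`, `Thread.ofCruciform` — a clean stage
axial for two charts `J ≠ K` carries the WHOLE binary tree `{J,K}^ℕ` of infinite corner threads; the kind «≤2-chart
corner threads» DECIDED iff-wise) and `section Pinf` (§6 lens-6's P∞ in lens-5's currency: root `pinfRoot =
⟨X_s·X_u²·X_w, 0⟩` (`q = 3`), `pinf_cruciform`, `pinf_not_offHeavy_u`, `pinf_isRoot`, `pinf_not_isolatedTop`,
`pinf_no_forcedWalk`, the threads `pinfThread K ω` for every word `ω : ℕ → Bool` (`pinfWord_injective`,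
`pinfThread_twoChartCornerTail`, `pinfThread_cruciform_not_isolated`, `pinfThread_F` = literally `s·u²·w` again) —
the MODEL rendering of lens-6's `Pinf_chart_s/_w`, `Pinf_top`, `Pinf_perpetual_certificate`, cited by name only).

[WRITER NOTE (decomp-res writer g12): file split only (tree files ≤ 400 lines); namespace, sections, section
variables / opens and every declaration exactly as in the lens (the node's HOME-only dupNamespace-linter line is
dropped; the namespace-level `open` lines of the node are replayed in every part).]

(Sources: Hauser2010 §§F–G (kangaroo points, corner calculus); HauserPerlega2019 §2; Hironaka1967;
CossartJannsenSaito2020 Ch. 8; CossartPiltant2008 §2; CornerTowerDescent (lens-5 g13, tree); DeltaCutRun2 (lens-6 g25, tree).)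
-/

open MvPolynomial
open Literature.AlgebraicGeometry.Resolution
open Literature.AlgebraicGeometry.Resolution.Hauser2010
open Literature.AlgebraicGeometry.Resolution.PointBlowup
open Summit.ResolutionOfSingularities.ResolutionOfSingularities.Theorems.TightDefectClasses
open Summit.ResolutionOfSingularities.ResolutionOfSingularities.Theorems.CornerTowerDescent
open Summit.ResolutionOfSingularities.ResolutionOfSingularities.Theorems.LassoCut

namespace Summit.ResolutionOfSingularities.ResolutionOfSingularities.Theorems.ThreadCut

section Existence

variable {K : Type} [Field K] [DecidableEq K] {q : ℕ}

/-! ## §5 EXACTNESS: a cruciform stage carries the whole binary tree of corner threads -/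

/-- A CRUCIFORM stage for the charts `J`, `K'`: all monomials of degree `≥ q`, off-heavy for `J` and for `K'` (both axes
are top lines; `J = K'` allowed = axial).  DEFINITION (the normal form of the kind). -/
def Cruciform (q : ℕ) (J K' : Fin 3) (F : MvPolynomial (Fin 3) K) : Prop :=
  (∀ m ∈ F.support, q ≤ m.degree) ∧ OffHeavy q J F ∧ OffHeavy q K' F

/-- The states along a CORNER WORD `ω` (all points `b = 0`) from `s₀`. DEFINITION (support). -/
noncomputable def cornerStates (q : ℕ) (ω : ℕ → Fin 3) (s₀ : State (Fin 3) K) : ℕ → State (Fin 3) K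
  | 0 => s₀
  | t + 1 => step q (ω t) 0 (cornerStates q ω s₀ t)

/-- The support after a corner step lies in the image of the support under the chart law. (Sources: Hauser2010, §F.) -/
theorem support_step_zero_subset (j : Fin 3) (s : State (Fin 3) K) (hall : ∀ m ∈ s.F.support, q ≤ m.degree) :
    (step q j 0 s).F.support ⊆ s.F.support.image (chartExponent q j) := by
  classical
  intro m hm
  rw [MvPolynomial.mem_support_iff] at hm
  change coeff m (deletePthPowers q (translate (0 : Fin 3 → K) (chartTransform q j s.F))) ≠ 0 at hm
  rw [PointBlowup.translate_zero, coeff_deletePthPowers] at hm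
  split_ifs at hm with hP
  · exact absurd rfl hm
  · rw [← HauserPerlega2024.support_chartTransform q _ hall]
    exact MvPolynomial.mem_support_iff.mpr hm

/-- A corner step in a heavy chart PRESERVES the cruciform normal form. (Sources: Hauser2010, §F.) -/
theorem cruciform_step {J K' j : Fin 3} {s : State (Fin 3) K} (h : Cruciform q J K' s.F) (hj : j = J ∨ j = K') :
    Cruciform q J K' (step q j 0 s).F := by
  classical
  obtain ⟨hall, hJ, hK⟩ := h
  have hjh : OffHeavy q j s.F := by rcases hj with rfl | rfl <;> assumption
  have key : ∀ m' ∈ (step q j 0 s).F.support, ∃ m ∈ s.F.support, m' = chartExponent q j m := fun m' hm' => by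
    obtain ⟨m, hm, rfl⟩ := Finset.mem_image.mp (support_step_zero_subset j s hall hm')
    exact ⟨m, hm, rfl⟩
  have heavy : ∀ k : Fin 3, OffHeavy q k s.F → OffHeavy q k (step q j 0 s).F := by
    intro k hk m' hm'
    obtain ⟨m, hm, rfl⟩ := key m' hm'
    by_cases hkj : k = j
    · rw [hkj, offDegree_chartExponent]; exact hjh m hm
    · have := offDegree_chartExponent_of_ne q hkj m (hall m hm)
      have h1 := hk m hm
      have h2 := hjh m hm
      omega
  refine ⟨fun m' hm' => ?_, heavy J hJ, heavy K' hK⟩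
  obtain ⟨m, hm, rfl⟩ := key m' hm'
  rw [degree_chartExponent]
  have := hjh m hm
  omega

/-- … so every stage along a corner word in the charts `J`, `K'` is cruciform. (Sources: Hauser2010, §F.) -/
theorem cruciform_cornerStates {J K' : Fin 3} {s₀ : State (Fin 3) K} (h₀ : Cruciform q J K' s₀.F) {ω : ℕ → Fin 3}
    (hω : ∀ t, ω t = J ∨ ω t = K') : ∀ t, Cruciform q J K' (cornerStates q ω s₀ t).F
  | 0 => h₀
  | t + 1 => cruciform_step (cruciform_cornerStates h₀ hω t) (hω t)

/-- The ORIGIN of a heavy chart of a cruciform stage is an EQUIMULTIPLE point (every new monomial has degree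
`≥ off ≥ q`). (Sources: Hauser2010, §F.) -/
theorem isEquimultiplePoint_of_cruciform {J K' j : Fin 3} {s : State (Fin 3) K} (h : Cruciform q J K' s.F)
    (hj : j = J ∨ j = K') : IsEquimultiplePoint q j 0 s := by
  classical
  obtain ⟨hall, hJ, hK⟩ := h
  have hjh : OffHeavy q j s.F := by rcases hj with rfl | rfl <;> assumption
  intro d hd0 hdq
  change coeff d (translate (0 : Fin 3 → K) (chartTransform q j s.F)) = 0
  rw [PointBlowup.translate_zero]
  by_contra hne
  have hmem : d ∈ (chartTransform q j s.F).support := MvPolynomial.mem_support_iff.mpr hne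
  rw [HauserPerlega2024.support_chartTransform q j hall] at hmem
  obtain ⟨m, hm, rfl⟩ := Finset.mem_image.mp hmem
  have h1 := hjh m hm
  rw [degree_chartExponent] at hdq
  omega

/-- **EXISTENCE HALF OF THE LAW**: a cruciform stage for `J`, `K'` carries, for EVERY word `ω ∈ {J, K'}^ℕ`, the infinite
corner thread playing `ω` (all `b = 0`).  With §4: two-chart corner threads exist EXACTLY over (eventually) cruciform /
axial stages — the kind is decided iff-wise. [DECIDED — PROVED here] (Sources: Hauser2010, §F.) -/
noncomputable def Thread.ofCruciform {J K' : Fin 3} (s₀ : State (Fin 3) K) (h₀ : Cruciform q J K' s₀.F) (ω : ℕ → Fin 3)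
    (hω : ∀ t, ω t = J ∨ ω t = K') : Thread q s₀ where
  j := ω
  b := fun _ => 0
  st := cornerStates q ω s₀
  st_zero := rfl
  st_succ := fun _ => rfl
  onExc := fun _ => rfl
  equimult := fun t => isEquimultiplePoint_of_cruciform (cruciform_cornerStates h₀ hω t) (hω t)

/-- bookkeeping. [folklore] -/
@[simp] theorem Thread.ofCruciform_j {J K' : Fin 3} (s₀ : State (Fin 3) K) (h₀ : Cruciform q J K' s₀.F)
    (ω : ℕ → Fin 3) (hω : ∀ t, ω t = J ∨ ω t = K') (t : ℕ) : (Thread.ofCruciform s₀ h₀ ω hω).j t = ω t := rfl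

/-- bookkeeping. [folklore] -/
@[simp] theorem Thread.ofCruciform_b {J K' : Fin 3} (s₀ : State (Fin 3) K) (h₀ : Cruciform q J K' s₀.F)
    (ω : ℕ → Fin 3) (hω : ∀ t, ω t = J ∨ ω t = K') (t : ℕ) : (Thread.ofCruciform s₀ h₀ ω hω).b t = 0 := rfl

/-- The threads of a cruciform stage are CRUCIFORM AT EVERY STAGE (not just eventually) … [DECIDED — PROVED here]
(Sources: Hauser2010, §F.) -/
theorem Thread.ofCruciform_cruciform {J K' : Fin 3} (s₀ : State (Fin 3) K) (h₀ : Cruciform q J K' s₀.F)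
    (ω : ℕ → Fin 3) (hω : ∀ t, ω t = J ∨ ω t = K') (t : ℕ) :
    Cruciform q J K' ((Thread.ofCruciform s₀ h₀ ω hω).st t).F :=
  cruciform_cornerStates h₀ hω t

/-- … hence NON-ISOLATED top points at every stage, with two top lines crossing there. [DECIDED — PROVED here]
(Sources: Hauser2010, §F.) -/
theorem Thread.ofCruciform_not_isolated {J K' : Fin 3} (s₀ : State (Fin 3) K) (h₀ : Cruciform q J K' s₀.F)
    (ω : ℕ → Fin 3) (hω : ∀ t, ω t = J ∨ ω t = K') (t : ℕ) :
    ¬ IsolatedTop q ((Thread.ofCruciform s₀ h₀ ω hω).st t).F ∧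
      topIdeal q ((Thread.ofCruciform s₀ h₀ ω hω).st t).F ≤
        Ideal.span (MvPolynomial.X '' {i : Fin 3 | i ≠ J}) ⊓ Ideal.span (MvPolynomial.X '' {i : Fin 3 | i ≠ K'}) := by
  obtain ⟨-, hJ, hK⟩ := Thread.ofCruciform_cruciform s₀ h₀ ω hω t
  exact ⟨not_isolatedTop_of_offHeavy hJ, topIdeal_le_cross_of_cruciform hJ hK⟩

/-- … and a cruciform stage carries NO forced walk at all (its top point is not isolated). [folklore] -/
theorem no_forcedWalk_of_cruciform {J K' : Fin 3} {s₀ : State (Fin 3) K} (h₀ : Cruciform q J K' s₀.F)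
    (W : ForcedWalk q s₀) : False := by
  have h := W.isolated 0
  rw [W.st_zero] at h
  exact not_isolatedTop_of_offHeavy h₀.2.1 h

end Existence

section Pinf

variable (K : Type) [Field K] [DecidableEq K]

/-! ## §6 THE JUNCTION CERTIFICATE: lens-6's P∞ = z³ + s·u²·w in lens-5's currency -/

/-- The exponent `(1,2,1)` of `s·u²·w` (indices `0 = s`, `1 = u`, `2 = w`). DEFINITION (support). -/
noncomputable def pinfExp : Fin 3 →₀ ℕ := Finsupp.single 0 1 + Finsupp.single 1 2 + Finsupp.single 2 1

/-- P∞'s residual polynomial `F = s·u²·w` of `z³ + s·u²·w` (lens-6 g26 `Pinf_*`; any field — characteristic 3 is where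
lens-6's BADNESS certificate lives, the thread structure below is characteristic-free). DEFINITION (support). -/
noncomputable def pinfF : MvPolynomial (Fin 3) K := monomial pinfExp 1

/-- P∞'s ROOT STATE of the E-model: `⟨s·u²·w, r = 0⟩`. DEFINITION (support). -/
noncomputable def pinfRoot : State (Fin 3) K := ⟨pinfF K, 0⟩

omit [DecidableEq K] in
/-- dictionary: `pinfF = X_s · X_u² · X_w`. [folklore] -/
theorem pinfF_eq : pinfF K = X 0 * X 1 ^ 2 * X 2 := by
  unfold pinfF pinfExp
  rw [MvPolynomial.X, MvPolynomial.X, MvPolynomial.X, monomial_pow, monomial_mul, monomial_mul]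
  simp

/-- arithmetic of `(1,2,1)`. [folklore] -/
theorem pinfExp_zero : pinfExp 0 = 1 := by simp [pinfExp]

/-- arithmetic of `(1,2,1)`. [folklore] -/
theorem pinfExp_one : pinfExp 1 = 2 := by simp [pinfExp]

/-- arithmetic of `(1,2,1)`. [folklore] -/
theorem pinfExp_two : pinfExp 2 = 1 := by simp [pinfExp]

/-- arithmetic of `(1,2,1)`. [folklore] -/
theorem pinfExp_degree : pinfExp.degree = 4 := by
  simp [pinfExp, map_add, Finsupp.degree_single]

omit [DecidableEq K] in
/-- the support of P∞'s polynomial is the single exponent `(1,2,1)`. [folklore] -/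
theorem support_pinfF : (pinfF K).support = {pinfExp} := by
  classical
  unfold pinfF
  rw [support_monomial, if_neg one_ne_zero]

omit [DecidableEq K] in
/-- **P∞ IS CRUCIFORM for `s` and `w`** (off-degrees `3 = q`): both the `s`-axis and the `w`-axis are TOP LINES (lens-6's
`Pinf_top`: top locus `L_s ∪ L_w`). [DECIDED — PROVED here] [folklore] -/
theorem pinf_cruciform : Cruciform 3 0 2 (pinfF K) := by
  refine ⟨fun m hm => ?_, fun m hm => ?_, fun m hm => ?_⟩ <;>
    rw [support_pinfF, Finset.mem_singleton] at hm <;> subst hm <;>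
    simp [pinfExp_degree, pinfExp_zero, pinfExp_two]

omit [DecidableEq K] in
/-- … and LIGHT for `u` (off-degree `2 < 3`): the `u`-axis is NOT a top line. [DECIDED — PROVED here] [folklore] -/
theorem pinf_not_offHeavy_u : ¬ OffHeavy 3 1 (pinfF K) := by
  intro h
  have := h pinfExp (by rw [support_pinfF, Finset.mem_singleton])
  rw [pinfExp_degree, pinfExp_one] at this
  omega

omit [DecidableEq K] in
/-- `(1,2,1)` is no cube exponent: P∞'s state is CLEAN. [folklore] -/
theorem pinfExp_not_isPthPowerExponent : ¬ IsPthPowerExponent 3 pinfExp := by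
  rw [isPthPowerExponent_iff]
  intro h
  have := h 0
  rw [pinfExp_zero] at this
  omega

omit [DecidableEq K] in
/-- **P∞'s state is a ROOT of lens-5's model** (`IsRoot 3`: `r = 0`, clean, `ord₀ = 4 ≥ 3`). [DECIDED — PROVED here]
[folklore] -/
theorem pinf_isRoot : IsRoot 3 (pinfRoot K) := by
  classical
  refine ⟨rfl, ?_, ?_⟩
  · change deletePthPowers 3 (pinfF K) = pinfF K
    unfold pinfF
    rw [deletePthPowers_monomial, if_neg pinfExp_not_isPthPowerExponent]
  · change ((3 : ℕ) : ℕ∞) ≤ ordZero (pinfF K)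
    unfold ordZero
    refine MvPowerSeries.nat_le_order fun d hd => ?_
    rw [MvPolynomial.coeff_coe]
    unfold pinfF
    rw [coeff_monomial, if_neg]
    rintro rfl
    rw [pinfExp_degree] at hd
    norm_num at hd

omit [DecidableEq K] in
/-- **P∞'s top point is NOT ISOLATED** (the `s`-axis is a top line). [DECIDED — PROVED here] [folklore] -/
theorem pinf_not_isolatedTop : ¬ IsolatedTop 3 (pinfF K) :=
  not_isolatedTop_of_offHeavy (pinf_cruciform K).2.1

/-- **P∞ CARRIES NO FORCED WALK** — the `isolated` binder of `ForcedWalk` fails at stage `0`: this is the ONE binder that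
keeps P∞'s threads outside every forced-walk cell of lens-5 / lens-3 ((J-0) consistency map). [DECIDED — PROVED
here] [folklore] -/
theorem pinf_no_forcedWalk (W : ForcedWalk 3 (pinfRoot K)) : False :=
  no_forcedWalk_of_cruciform (q := 3) (s₀ := pinfRoot K) (pinf_cruciform K) W

/-- P∞'s chart words: `true ↦ s` (chart `0`), `false ↦ w` (chart `2`). DEFINITION (support). -/
def pinfWord (ω : ℕ → Bool) : ℕ → Fin 3 := fun t => if ω t then 0 else 2

variable {K}

omit [Field K] [DecidableEq K] in
/-- every letter of a P∞ word is `s` or `w`. [folklore] -/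
theorem pinfWord_mem (ω : ℕ → Bool) (t : ℕ) : pinfWord ω t = 0 ∨ pinfWord ω t = 2 := by
  unfold pinfWord; split <;> simp

omit [Field K] [DecidableEq K] in
/-- distinct words give distinct chart sequences (`2^ω` threads). [folklore] -/
theorem pinfWord_injective : Function.Injective pinfWord := by
  intro ω ω' h
  funext t
  have := congrFun h t
  unfold pinfWord at this
  cases hω : ω t <;> cases hω' : ω' t <;> simp_all

variable (K)

/-- **P∞'s THREADS IN LENS-5's CURRENCY**: for EVERY word `ω : ℕ → Bool` the infinite corner thread playing `s`/`w` with
all points `b = 0` — lens-6's bad threads of P∞ (`bad_i = 2^i`, `Pinf_perpetual_certificate`, `Pinf_chart_s/_w`) typed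
as `Thread 3 pinfRoot`. [DECIDED — PROVED here (the existence half §5 applied to `pinf_cruciform`)] -/
noncomputable def pinfThread (ω : ℕ → Bool) : Thread 3 (pinfRoot K) :=
  Thread.ofCruciform (pinfRoot K) (pinf_cruciform K) (pinfWord ω) (pinfWord_mem ω)

/-- Every P∞ thread is a TWO-CHART CORNER TAIL from `t = 0` avoiding the chart `u`. [DECIDED — PROVED here] [folklore] -/
theorem pinfThread_twoChartCornerTail (ω : ℕ → Bool) : (pinfThread K ω).TwoChartCornerTailFrom 1 0 := by
  intro t _
  refine ⟨rfl, ?_⟩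
  change pinfWord ω (t + 1) ≠ 1
  rcases pinfWord_mem ω (t + 1) with h | h <;> rw [h] <;> decide

/-- Every P∞ thread is CRUCIFORM (`s`- and `w`-axial) at EVERY stage, its top point NON-ISOLATED with the two top lines
`L_s`, `L_w` crossing there: P∞ inhabits the NonIso side of §7 (model certificate). [DECIDED — PROVED here] [folklore] -/
theorem pinfThread_cruciform_not_isolated (ω : ℕ → Bool) (t : ℕ) :
    Cruciform 3 0 2 ((pinfThread K ω).st t).F ∧ ¬ IsolatedTop 3 ((pinfThread K ω).st t).F ∧
      topIdeal 3 ((pinfThread K ω).st t).F ≤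
        Ideal.span (MvPolynomial.X '' {i : Fin 3 | i ≠ 0}) ⊓ Ideal.span (MvPolynomial.X '' {i : Fin 3 | i ≠ 2}) :=
  ⟨Thread.ofCruciform_cruciform _ _ _ _ t, Thread.ofCruciform_not_isolated _ _ _ _ t⟩

/-- the chart law FIXES `(1,2,1)` in the charts `s` and `w` (`λ_s(1,2,1) = (4−3,2,1)`, `λ_w(1,2,1) = (1,2,4−3)`).
[folklore] -/
theorem chartExponent_pinfExp {j : Fin 3} (hj : j = 0 ∨ j = 2) : chartExponent 3 j pinfExp = pinfExp := by
  ext i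
  rw [chartExponent_apply]
  split_ifs with h
  · subst h
    rw [pinfExp_degree]
    rcases hj with rfl | rfl
    · rw [pinfExp_zero]
    · rw [pinfExp_two]
  · rfl

/-- **SELF-REPRODUCTION** (lens-6's `Pinf_chart_s` / `Pinf_chart_w` in the E-model): along every P∞ thread the residual
polynomial is LITERALLY `s·u²·w` at every stage. [DECIDED — PROVED here] [folklore] -/
theorem pinfThread_F (ω : ℕ → Bool) : ∀ t : ℕ, ((pinfThread K ω).st t).F = pinfF K
  | 0 => rfl
  | t + 1 => by
    classical
    have ih := pinfThread_F ω t
    rw [(pinfThread K ω).st_succ t]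
    change deletePthPowers 3 (translate ((pinfThread K ω).b t) (chartTransform 3 ((pinfThread K ω).j t)
      ((pinfThread K ω).st t).F)) = pinfF K
    rw [ih, show (pinfThread K ω).b t = 0 from rfl, PointBlowup.translate_zero,
      show (pinfThread K ω).j t = pinfWord ω t from rfl]
    have hct : chartTransform 3 (pinfWord ω t) (pinfF K) = pinfF K := by
      unfold chartTransform
      rw [support_pinfF, Finset.sum_singleton, chartExponent_pinfExp (pinfWord_mem ω t)]
      unfold pinfF
      rw [coeff_monomial, if_pos rfl]
    rw [hct]
    unfold pinfF
    rw [deletePthPowers_monomial, if_neg pinfExp_not_isPthPowerExponent]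

end Pinf

end Summit.ResolutionOfSingularities.ResolutionOfSingularities.Theorems.ThreadCut
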